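import Mathlib
import HarnessLib
import Literature.Combinatorics.Additive.StepBeyondKempermanReduction

/-!
# Grynkiewicz 2009, §6 Claim 6: the case `|A| = |B| = 3` of Theorem 4.1

[cite: Grynkiewicz2009, §6 Claim 6 (proof of Thm 4.1)] [tag: critical-pair] [tag: inverse-theorem]

Topic `Literature/Combinatorics/Additive`.  Cell `mm-stpp` (D-0046), seat `mm-stpp-lit` (gen 23); the
port of D. J. Grynkiewicz, *A step beyond Kemperman's structure theorem*, Mathematika **55** (2009)
67–114 continued.  §6, **Claim 6** (print pp. 26–27): «`max{|A|, |B|} ≥ 4`, say `|B| ≥ 4`.  Suppose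
instead that `|A| = |B| = 3` (in view of Claim 3).  If `(A − A) ∩ (B − B) = {0}`, then
`|A + B| = |A||B| = 9 > 6 = |A| + |B|`, a contradiction.  Thus w.l.o.g. `A = {0, d, a₁}` and
`B = {0, d, a₂}`.  In view of Lemma 5.8 … we can assume neither `A` nor `B` is an arithmetic
progression, else the proof is complete.  Since `A` is not quasi-periodic (Claim 4) and `|A| = 3`, it
follows that no two elements from `A` can form a coset of an order two subgroup.  Likewise for `B`.
Note (44) `A + B = {0, d, 2d, a₁, a₁ + d, a₂, a₂ + d, a₁ + a₂}`.  If `a₁ = a₂`, then the theorem follows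
with type (VI).  If `|{0, d, 2d}| ≤ 2`, then `{0, d}` is a subgroup of order 2, which we have noted is not
the case.  Therefore `|{0, d, 2d}| = 3` and `2d ≠ 0`.  Since neither `A` nor `B` is an arithmetic
progression, it follows that `a₁, a₂ ∉ {2d, −d}`.  Hence, since `a₁ + d = a₂` and `a₂ + d = a₁` together
contradict that `2d ≠ 0`, it follows that `|{0, d, 2d, a₁, a₁ + d, a₂, a₂ + d}| ≥ … ≥ 6`, with equality
possible only if w.l.o.g. `a₂ = a₁ + d`.  Thus in view of (44) and `|A + B| = 6`, it follows that
`a₁ + a₂ = 2a₁ + d ∈ A + B = {0, d, 2d, a₁, a₁ + d, a₁ + 2d}`, implying that one of the following hold: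
`2a₁ + d = 0`, `2a₁ = 0`, `2a₁ = d`, `a₁ = −d`, `a₁ = 0`, or `a₁ = d`.  The last three equalities are
contradictions.  If `2a₁ = 0`, then `{0, a₁}` is a coset of an order two subgroup, if `2a₁ = d`, then
`A = {0, d, a₁} = {0, 2a₁, a₁}` is an arithmetic progression, and if `−2a₁ = d`, then
`B = {0, d, a₁ + d} = {0, −2a₁, −a₁}` is an arithmetic progression, all contradictions as well.»

MAIN RESULT (0 definitions, 0 named facts; everything PROVED).
* `Grynkiewicz2009.conclusion_of_card_eq_three` — **CLAIM 6**: `|A| = |B| = 3`, `|A + B| = |A| + |B|`,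
  `A + B` aperiodic, `A` and `B` not quasi-periodic ⟹ the conclusion of Theorem 4.1 ((17), or a
  decomposition — here with quasi-period `G` and bottom pair of type (VI)).  The proof is the printed
  one, verbatim: a common difference (`exists_common_difference`, the count `|A + B| < |A||B|`), the
  translation to `0, d ∈ A ∩ B` (`conclusion_of_card_eq_three₀`), Lemma 5.8
  (`subsetDist_quasiProgression_of_isAP`) for a progression summand, «no two elements form a coset of
  an order two subgroup» (`add_self_sub_ne_zero_of_not_isQuasiPeriodic`), type (VI) when `a₁ = a₂`
  (`isGrynkiewiczDecomp_top_of_bottom`), and the final count (`claim6_count`: seven distinct sums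
  unless `a₂ = a₁ + d` or `a₁ = a₂ + d`; `claim6_final`: the six values of `2a₁ + d`).
No standing assumption beyond those listed is used (non-extendibility, `d⊆(A + B, 𝒫) ≥ 3` and
`⟨A⟩ = G` are not needed for Claim 6).

## References
* D. J. Grynkiewicz, *A step beyond Kemperman's structure theorem*, Mathematika 55 (2009) 67–114,
  doi:10.1112/S0025579300000966, §6 Claim 6 (pp. 26–27), Lemma 5.8 (p. 20)
  [cite: Grynkiewicz2009, Thm 4.1 (proof, Claim 6)] — held `paper:doi-10-1112-s0025579300000966`,
  p0026–p0027 read 2026-08-29.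
-/

namespace Literature.Combinatorics.Additive

open Finset
open scoped Pointwise

universe u

variable {G : Type u} [AddCommGroup G] [DecidableEq G]

namespace Grynkiewicz2009

/-! ### Small tools -/

omit [DecidableEq G] in
/-- Linear rearrangement: `P = Q` from `R = S` when `P − Q = R − S`. [folklore] -/
private theorem eq_of_abel {P Q R S : G} (h : R = S) (e : P - Q = R - S) : P = Q := by
  rw [← sub_eq_zero] at h ⊢; rwa [e]

omit [DecidableEq G] in
/-- Linear rearrangement: `P ≠ Q` from `R ≠ S` when `P − Q = R − S`. [folklore] -/
private theorem ne_of_abel {P Q R S : G} (h : R ≠ S) (e : P - Q = R - S) : P ≠ Q :=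
  fun hPQ => h (eq_of_abel hPQ e.symm)

/-- `(g + A) + (g' + B) = (g + g') + (A + B)` (a copy of the private lemma of
`KempermanElementaryPairs.lean`). [cite: Grynkiewicz2009, §2] -/
private theorem vadd_add_vadd_eq₃ (A B : Finset G) (g g' : G) :
    (g +ᵥ A) + (g' +ᵥ B) = (g + g') +ᵥ (A + B) := by
  rw [vadd_add_assoc, add_comm A (g' +ᵥ B), vadd_add_assoc, vadd_vadd, add_comm B A]

/-- Three-term progressions explicitly: `{a, a + d, a + 2d}`. [cite: Grynkiewicz2009, §2] -/
theorem apFinset_three (a d : G) : apFinset a d 3 = {a, a + d, a + d + d} := by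
  ext x
  rw [mem_apFinset]
  simp only [mem_insert, mem_singleton]
  constructor
  · rintro ⟨i, hi, rfl⟩
    interval_cases i
    · exact Or.inl (by rw [zero_nsmul, add_zero])
    · exact Or.inr (Or.inl (by rw [one_nsmul]))
    · exact Or.inr (Or.inr (by rw [two_nsmul, add_assoc]))
  · rintro (rfl | rfl | rfl)
    · exact ⟨0, by omega, by rw [zero_nsmul, add_zero]⟩
    · exact ⟨1, by omega, by rw [one_nsmul]⟩
    · exact ⟨2, by omega, by rw [two_nsmul, add_assoc]⟩

/-- A three-element set listed as `{a, a + d, a + 2d}` is an arithmetic progression with difference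
`d`. [cite: Grynkiewicz2009, §2] -/
theorem isAP_of_eq_triple {A : Finset G} {a d : G} (h3 : #A = 3) (h : A = {a, a + d, a + d + d}) :
    IsAP A d :=
  ⟨a, by rw [h3, apFinset_three]; exact h⟩

omit [AddCommGroup G] in
/-- A three-element set through two given elements `x ≠ y` is `{x, y, z}` with `z ≠ x, y`.
[cite: Grynkiewicz2009, §6 Claim 6 («w.l.o.g. A = {0, d, a₁}»)] -/
theorem eq_triple_of_card_eq_three {A : Finset G} (h3 : #A = 3) {x y : G} (hx : x ∈ A) (hy : y ∈ A)
    (hxy : x ≠ y) : ∃ z, z ≠ x ∧ z ≠ y ∧ A = {x, y, z} := by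
  have hsub : ({x, y} : Finset G) ⊆ A := insert_subset hx (singleton_subset_iff.2 hy)
  have hcard : #(A \ {x, y}) = 1 := by rw [card_sdiff_of_subset hsub, h3, card_pair hxy]
  obtain ⟨z, hz⟩ := card_eq_one.1 hcard
  have hzmem : z ∈ A \ {x, y} := by rw [hz]; exact mem_singleton_self _
  rw [mem_sdiff, mem_insert, mem_singleton, not_or] at hzmem
  refine ⟨z, hzmem.2.1, hzmem.2.2, ?_⟩
  rw [← union_sdiff_of_subset hsub, hz, insert_union, ← insert_eq]

/-- The pigeonhole behind «if `(A − A) ∩ (B − B) = {0}`, then `|A + B| = |A||B|`»: if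
`|A + B| < |A||B|`, two distinct elements of `A` and two of `B` have a common difference.
[cite: Grynkiewicz2009, §6 Claim 6] -/
theorem exists_common_difference {A B : Finset G} (h : #(A + B) < #A * #B) :
    ∃ a ∈ A, ∃ a' ∈ A, ∃ b ∈ B, ∃ b' ∈ B, a ≠ a' ∧ a - a' = b - b' := by
  classical
  by_contra hne
  push Not at hne
  have hinj : Set.InjOn (fun p : G × G => p.1 + p.2) ↑(A ×ˢ B) := by
    rintro ⟨a, b⟩ hab ⟨a', b'⟩ hab' he
    rw [mem_coe, mem_product] at hab hab'
    dsimp only at he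
    have hdiff : a - a' = b' - b := eq_of_abel he (by abel)
    by_cases haa : a = a'
    · subst haa
      have hbb : b = b' := add_left_cancel he
      rw [hbb]
    · exact absurd hdiff (hne a hab.1 a' hab'.1 b' hab'.2 b hab.2 haa)
  have := card_image_of_injOn hinj
  rw [image_add_product, card_product] at this
  omega

/-- «Since `A` is not quasi-periodic and `|A| = 3`, it follows that no two elements from `A` can form a
coset of an order two subgroup»: for `x ≠ y` in `A`, `2(y − x) ≠ 0` (else `A = {x, y} ∪ {z}` is a
quasi-periodic decomposition with quasi-period the stabilizer of `{x, y}`).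
[cite: Grynkiewicz2009, §6 Claim 6] -/
theorem add_self_sub_ne_zero_of_not_isQuasiPeriodic {A : Finset G} (hA : ¬ IsQuasiPeriodic A)
    (h3 : #A = 3) {x y : G} (hx : x ∈ A) (hy : y ∈ A) (hxy : x ≠ y) : (y - x) + (y - x) ≠ 0 := by
  classical
  intro h2
  apply hA
  let H : AddSubgroup G := AddAction.stabilizer G ({x, y} : Finset G)
  have hmemH : ∀ g, g ∈ H ↔ g +ᵥ ({x, y} : Finset G) = {x, y} := fun g => AddAction.mem_stabilizer_iff
  have heH : y - x ∈ H := by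
    rw [hmemH, vadd_finset_insert, vadd_finset_singleton]
    have e1 : (y - x) +ᵥ x = y := by rw [vadd_eq_add, sub_add_cancel]
    have e2 : (y - x) +ᵥ y = x := by rw [vadd_eq_add]; exact eq_of_abel h2 (by abel)
    rw [e1, e2, pair_comm]
  have hsub : ({x, y} : Finset G) ⊆ A := insert_subset hx (singleton_subset_iff.2 hy)
  have hcard : #(A \ {x, y}) = 1 := by rw [card_sdiff_of_subset hsub, h3, card_pair hxy]
  obtain ⟨z, hz⟩ := card_eq_one.1 hcard
  refine ⟨H, {x, y}, A \ {x, y}, ⟨?_, disjoint_sdiff, union_sdiff_of_subset hsub,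
    fun g hg => (hmemH g).1 hg, ?_⟩, ⟨x, mem_insert_self _ _⟩⟩
  · intro hbot
    have := heH
    rw [hbot, AddSubgroup.mem_bot, sub_eq_zero] at this
    exact hxy this.symm
  · intro u hu v hv
    rw [hz, mem_singleton] at hu hv
    rw [hu, hv, sub_self]; exact H.zero_mem

/-- The decomposition of Theorem 4.1 with quasi-period `G` («the theorem follows with type (VI)»,
resp. (V), and group `G`): empty periodic parts, (i) and (ii) trivial.
[cite: Grynkiewicz2009, §6 Claims 3 and 6] -/
theorem isGrynkiewiczDecomp_top_of_bottom {A B : Finset G} (hG : (⊤ : AddSubgroup G) ≠ ⊥)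
    (hA : A.Nonempty) (hB : B.Nonempty)
    (hbot : IsTypeV A B ∨ IsTypeVI A B ∨ IsTypeVII A B ∨ IsTypeVIII A B) :
    IsGrynkiewiczDecomp ⊤ A B ∅ A ∅ B where
  decomp_left := IsQuasiPeriodicDecomp.top A hG
  decomp_right := IsQuasiPeriodicDecomp.top B hG
  left_nonempty := hA
  right_nonempty := hB
  quot_unique := fun _ _ _ _ _ _ _ _ _ => ⟨AddSubgroup.mem_top _, AddSubgroup.mem_top _⟩
  cosetCount_add := by
    rw [cosetCount_eq_one_of_sub_mem (hA.add hB) (fun _ _ _ _ => AddSubgroup.mem_top _),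
      cosetCount_eq_one_of_sub_mem hA (fun _ _ _ _ => AddSubgroup.mem_top _),
      cosetCount_eq_one_of_sub_mem hB (fun _ _ _ _ => AddSubgroup.mem_top _)]
  bottom := hbot

/-! ### The arithmetic of Claim 6 -/

/-- The exclusions for `A = {0, d, a}`: `2d ≠ 0` and `2a ≠ 0` (no coset of an order-two subgroup inside
`A`), `a ∉ {2d, −d}` and `2a ≠ d` (`A` is not an arithmetic progression).
[cite: Grynkiewicz2009, §6 Claim 6] -/
theorem claim6_facts {A : Finset G} {d a : G} (hA3 : #A = 3) (hAeq : A = {0, d, a}) (hd : d ≠ 0)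
    (ha0 : a ≠ 0) (hAP : ¬ ∃ e, IsAP A e) (hAqp : ¬ IsQuasiPeriodic A) :
    d + d ≠ 0 ∧ a + a ≠ 0 ∧ a ≠ d + d ∧ a ≠ -d ∧ a + a ≠ d := by
  have h0A : (0 : G) ∈ A := by rw [hAeq]; simp
  have hdA : d ∈ A := by rw [hAeq]; simp
  have haA : a ∈ A := by rw [hAeq]; simp
  refine ⟨?_, ?_, ?_, ?_, ?_⟩
  · have := add_self_sub_ne_zero_of_not_isQuasiPeriodic hAqp hA3 h0A hdA hd.symm
    rwa [sub_zero] at this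
  · have := add_self_sub_ne_zero_of_not_isQuasiPeriodic hAqp hA3 h0A haA ha0.symm
    rwa [sub_zero] at this
  · intro h; apply hAP
    refine ⟨d, isAP_of_eq_triple (a := 0) hA3 ?_⟩
    rw [zero_add, hAeq, h]
  · intro h; apply hAP
    refine ⟨d, isAP_of_eq_triple (a := -d) hA3 ?_⟩
    rw [neg_add_cancel, zero_add, hAeq, h]
    ext w; simp only [mem_insert, mem_singleton]; tauto
  · intro h; apply hAP
    refine ⟨a, isAP_of_eq_triple (a := 0) hA3 ?_⟩
    rw [zero_add, h, hAeq]
    ext w; simp only [mem_insert, mem_singleton]; tauto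

/-- «if `−2a₁ = d`, then `B = {0, d, a₁ + d} = {0, −2a₁, −a₁}` is an arithmetic progression».
[cite: Grynkiewicz2009, §6 Claim 6] -/
theorem claim6_isAP_of_eq {B : Finset G} {d a : G} (hB3 : #B = 3) (hBeq : B = {0, d, a + d})
    (h : a + a + d = 0) : IsAP B (-a) := by
  refine isAP_of_eq_triple (a := 0) hB3 ?_
  rw [zero_add, hBeq]
  have hd : d = -a + -a := eq_of_abel h (by abel)
  have had : a + d = -a := eq_of_abel h (by abel)
  rw [had, hd]
  ext w; simp only [mem_insert, mem_singleton]; tauto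

/-- The count of Claim 6, first half: for `A = {0, d, a₁} `, `B = {0, d, a₂}` with the exclusions,
`a₁ ≠ a₂` and `|A + B| = 6`, the seven sums `0, d, 2d, a₁, a₁ + d, a₂, a₂ + d` cannot be distinct, so
`a₂ = a₁ + d` or `a₁ = a₂ + d` («with equality possible only if w.l.o.g. `a₂ = a₁ + d`»).
[cite: Grynkiewicz2009, §6 Claim 6] -/
theorem claim6_count {A B : Finset G} {d a₁ a₂ : G}
    (h0A : (0 : G) ∈ A) (hdA : d ∈ A) (ha₁A : a₁ ∈ A) (h0B : (0 : G) ∈ B) (hdB : d ∈ B) (ha₂B : a₂ ∈ B)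
    (hAB6 : #(A + B) = 6) (hd : d ≠ 0) (h2d : d + d ≠ 0)
    (ha₁0 : a₁ ≠ 0) (ha₁d : a₁ ≠ d) (ha₂0 : a₂ ≠ 0) (ha₂d : a₂ ≠ d) (h12 : a₁ ≠ a₂)
    (ha₁2d : a₁ ≠ d + d) (ha₁nd : a₁ ≠ -d) (ha₂2d : a₂ ≠ d + d) (ha₂nd : a₂ ≠ -d) :
    a₂ = a₁ + d ∨ a₁ = a₂ + d := by
  by_contra hne
  rw [not_or] at hne
  -- the seven sums lie in `A + B`
  have hsub : ({0, d, d + d, a₁, a₁ + d, a₂, d + a₂} : Finset G) ⊆ A + B := by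
    intro w hw
    simp only [mem_insert, mem_singleton] at hw
    rcases hw with rfl | rfl | rfl | rfl | rfl | rfl | rfl
    · simpa using add_mem_add h0A h0B
    · simpa using add_mem_add h0A hdB
    · exact add_mem_add hdA hdB
    · simpa using add_mem_add ha₁A h0B
    · exact add_mem_add ha₁A hdB
    · simpa using add_mem_add h0A ha₂B
    · exact add_mem_add hdA ha₂B
  -- and are distinct
  have f1 : (0 : G) ∉ ({d, d + d, a₁, a₁ + d, a₂, d + a₂} : Finset G) := by
    simp only [mem_insert, mem_singleton, not_or]
    exact ⟨hd.symm, h2d.symm, ha₁0.symm, ne_of_abel ha₁nd.symm (by abel), ha₂0.symm,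
      ne_of_abel ha₂nd.symm (by abel)⟩
  have f2 : d ∉ ({d + d, a₁, a₁ + d, a₂, d + a₂} : Finset G) := by
    simp only [mem_insert, mem_singleton, not_or]
    exact ⟨ne_of_abel hd.symm (by abel), ha₁d.symm, ne_of_abel ha₁0.symm (by abel), ha₂d.symm,
      ne_of_abel ha₂0.symm (by abel)⟩
  have f3 : d + d ∉ ({a₁, a₁ + d, a₂, d + a₂} : Finset G) := by
    simp only [mem_insert, mem_singleton, not_or]
    exact ⟨ha₁2d.symm, ne_of_abel ha₁d.symm (by abel), ha₂2d.symm, ne_of_abel ha₂d.symm (by abel)⟩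
  have f4 : a₁ ∉ ({a₁ + d, a₂, d + a₂} : Finset G) := by
    simp only [mem_insert, mem_singleton, not_or]
    exact ⟨ne_of_abel hd.symm (by abel), h12, ne_of_abel hne.2 (by abel)⟩
  have f5 : a₁ + d ∉ ({a₂, d + a₂} : Finset G) := by
    simp only [mem_insert, mem_singleton, not_or]
    exact ⟨fun h => hne.1 h.symm, ne_of_abel h12 (by abel)⟩
  have f6 : a₂ ≠ d + a₂ := ne_of_abel hd.symm (by abel)
  have hcard : #({0, d, d + d, a₁, a₁ + d, a₂, d + a₂} : Finset G) = 7 := by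
    rw [card_insert_of_notMem f1, card_insert_of_notMem f2, card_insert_of_notMem f3,
      card_insert_of_notMem f4, card_insert_of_notMem f5, card_pair f6]
  have := card_le_card hsub
  rw [hcard, hAB6] at this
  omega

/-- The count of Claim 6, second half: for `A = {0, d, a₁}`, `B = {0, d, a₁ + d}` with the exclusions
and `|A + B| = 6`, the six sums `0, d, 2d, a₁, a₁ + d, a₁ + 2d` exhaust `A + B`, and then
`a₁ + a₂ = 2a₁ + d ∈ A + B` is one of them — each of the six equalities is excluded.
[cite: Grynkiewicz2009, §6 Claim 6] -/
theorem claim6_final {A B : Finset G} {d a₁ : G}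
    (h0A : (0 : G) ∈ A) (hdA : d ∈ A) (ha₁A : a₁ ∈ A) (h0B : (0 : G) ∈ B) (hdB : d ∈ B)
    (ha₂B : a₁ + d ∈ B) (hAB6 : #(A + B) = 6) (hd : d ≠ 0) (h2d : d + d ≠ 0)
    (ha₁0 : a₁ ≠ 0) (ha₁d : a₁ ≠ d) (ha₁2d : a₁ ≠ d + d) (ha₁nd : a₁ ≠ -d) (ha₂nd : a₁ + d ≠ -d)
    (h2a₁ : a₁ + a₁ ≠ 0) (h2a₁d : a₁ + a₁ ≠ d) (h2a₁nd : a₁ + a₁ + d ≠ 0) : False := by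
  have hsub : ({0, d, d + d, a₁, a₁ + d, d + (a₁ + d)} : Finset G) ⊆ A + B := by
    intro w hw
    simp only [mem_insert, mem_singleton] at hw
    rcases hw with rfl | rfl | rfl | rfl | rfl | rfl
    · simpa using add_mem_add h0A h0B
    · simpa using add_mem_add h0A hdB
    · exact add_mem_add hdA hdB
    · simpa using add_mem_add ha₁A h0B
    · exact add_mem_add ha₁A hdB
    · exact add_mem_add hdA ha₂B
  have g1 : (0 : G) ∉ ({d, d + d, a₁, a₁ + d, d + (a₁ + d)} : Finset G) := by
    simp only [mem_insert, mem_singleton, not_or]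
    exact ⟨hd.symm, h2d.symm, ha₁0.symm, ne_of_abel ha₁nd.symm (by abel),
      ne_of_abel ha₂nd.symm (by abel)⟩
  have g2 : d ∉ ({d + d, a₁, a₁ + d, d + (a₁ + d)} : Finset G) := by
    simp only [mem_insert, mem_singleton, not_or]
    exact ⟨ne_of_abel hd.symm (by abel), ha₁d.symm, ne_of_abel ha₁0.symm (by abel),
      ne_of_abel ha₁nd.symm (by abel)⟩
  have g3 : d + d ∉ ({a₁, a₁ + d, d + (a₁ + d)} : Finset G) := by
    simp only [mem_insert, mem_singleton, not_or]
    exact ⟨ha₁2d.symm, ne_of_abel ha₁d.symm (by abel), ne_of_abel ha₁0.symm (by abel)⟩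
  have g4 : a₁ ∉ ({a₁ + d, d + (a₁ + d)} : Finset G) := by
    simp only [mem_insert, mem_singleton, not_or]
    exact ⟨ne_of_abel hd.symm (by abel), ne_of_abel h2d.symm (by abel)⟩
  have g5 : a₁ + d ≠ d + (a₁ + d) := ne_of_abel hd.symm (by abel)
  have hcard : #({0, d, d + d, a₁, a₁ + d, d + (a₁ + d)} : Finset G) = 6 := by
    rw [card_insert_of_notMem g1, card_insert_of_notMem g2, card_insert_of_notMem g3,
      card_insert_of_notMem g4, card_pair g5]
  have heq : ({0, d, d + d, a₁, a₁ + d, d + (a₁ + d)} : Finset G) = A + B :=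
    eq_of_subset_of_card_le hsub (by rw [hAB6, hcard])
  have hu : a₁ + (a₁ + d) ∈ A + B := add_mem_add ha₁A ha₂B
  rw [← heq] at hu
  simp only [mem_insert, mem_singleton] at hu
  rcases hu with h | h | h | h | h | h
  · exact h2a₁nd (eq_of_abel h (by abel))
  · exact h2a₁ (eq_of_abel h (by abel))
  · exact h2a₁d (eq_of_abel h (by abel))
  · exact ha₁nd (eq_of_abel h (by abel))
  · exact ha₁0 (eq_of_abel h (by abel))
  · exact ha₁d (eq_of_abel h (by abel))

/-! ### Claim 6 -/

/-- **Claim 6 in normal position** (`0, d ∈ A ∩ B`, `d ≠ 0`): `|A| = |B| = 3`, `|A + B| = |A| + |B|`,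
`A + B` aperiodic, `A`, `B` not quasi-periodic ⟹ the conclusion of Theorem 4.1.  Proof as printed
(see the module docstring). [cite: Grynkiewicz2009, §6 Claim 6 (proof of Thm 4.1, pp. 26–27)] -/
theorem conclusion_of_card_eq_three₀ {A B : Finset G} {d : G} (hd : d ≠ 0)
    (h0A : (0 : G) ∈ A) (hdA : d ∈ A) (h0B : (0 : G) ∈ B) (hdB : d ∈ B)
    (hA3 : #A = 3) (hB3 : #B = 3) (hAB : #(A + B) = #A + #B) (haper : (A + B).addStab = {0})
    (hAqp : ¬ IsQuasiPeriodic A) (hBqp : ¬ IsQuasiPeriodic B) :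
    (∃ α β : G, #(insert α A + insert β B) + 1 = #(insert α A) + #(insert β B)) ∨
      ∃ (K : AddSubgroup G) (A₁ A₀ B₁ B₀ : Finset G), IsGrynkiewiczDecomp K A B A₁ A₀ B₁ B₀ := by
  classical
  have hBA : #(B + A) = #B + #A := by rw [add_comm, hAB, add_comm]
  have haper' : (B + A).addStab = {0} := by rwa [add_comm]
  -- Lemma 5.8: an arithmetic-progression summand gives (17)
  by_cases hAP : ∃ e, IsAP A e
  · obtain ⟨e, he⟩ := hAP
    exact Or.inl (subsetDist_quasiProgression_of_isAP hAB (by omega) haper he).2.2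
  by_cases hBP : ∃ e, IsAP B e
  · obtain ⟨e, he⟩ := hBP
    exact Or.inl (seventeen_symm (subsetDist_quasiProgression_of_isAP hBA (by omega) haper' he).2.2)
  -- `A = {0, d, a₁}`, `B = {0, d, a₂}`
  obtain ⟨a₁, ha₁0, ha₁d, hAeq⟩ := eq_triple_of_card_eq_three hA3 h0A hdA hd.symm
  obtain ⟨a₂, ha₂0, ha₂d, hBeq⟩ := eq_triple_of_card_eq_three hB3 h0B hdB hd.symm
  have ha₁A : a₁ ∈ A := by rw [hAeq]; simp
  have ha₂B : a₂ ∈ B := by rw [hBeq]; simp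
  -- `a₁ = a₂`: type (VI) with group `G`
  have hG : (⊤ : AddSubgroup G) ≠ ⊥ := by
    intro h
    have hdtop : d ∈ (⊤ : AddSubgroup G) := AddSubgroup.mem_top d
    rw [h] at hdtop
    exact hd (AddSubgroup.mem_bot.1 hdtop)
  by_cases h12 : a₁ = a₂
  · have hABeq : A = B := by rw [hAeq, hBeq, h12]
    exact Or.inr ⟨⊤, ∅, A, ∅, B, isGrynkiewiczDecomp_top_of_bottom hG ⟨0, h0A⟩ ⟨0, h0B⟩
      (Or.inr (Or.inl ⟨hA3, hB3, ⟨0, by rw [zero_vadd, hABeq]⟩, hAB⟩))⟩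
  -- the exclusions, and the count
  obtain ⟨h2d, h2a₁, ha₁2d, ha₁nd, h2a₁d⟩ := claim6_facts hA3 hAeq hd ha₁0 hAP hAqp
  obtain ⟨-, h2a₂, ha₂2d, ha₂nd, h2a₂d⟩ := claim6_facts hB3 hBeq hd ha₂0 hBP hBqp
  have hAB6 : #(A + B) = 6 := by rw [hAB, hA3, hB3]
  exfalso
  rcases claim6_count h0A hdA ha₁A h0B hdB ha₂B hAB6 hd h2d ha₁0 ha₁d ha₂0 ha₂d h12 ha₁2d ha₁nd
    ha₂2d ha₂nd with hc | hc
  · subst hc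
    exact claim6_final h0A hdA ha₁A h0B hdB ha₂B hAB6 hd h2d ha₁0 ha₁d ha₁2d ha₁nd ha₂nd h2a₁ h2a₁d
      (fun h => hBP ⟨-a₁, claim6_isAP_of_eq hB3 hBeq h⟩)
  · subst hc
    have hBA6 : #(B + A) = 6 := by rw [add_comm]; exact hAB6
    exact claim6_final h0B hdB ha₂B h0A hdA ha₁A hBA6 hd h2d ha₂0 ha₂d ha₂2d ha₂nd ha₁nd h2a₂ h2a₂d
      (fun h => hAP ⟨-a₂, claim6_isAP_of_eq hA3 hAeq h⟩)

/-- **§6 Claim 6 («`max{|A|, |B|} ≥ 4`»): the case `|A| = |B| = 3` of Theorem 4.1.**  If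
`|A| = |B| = 3`, `|A + B| = |A| + |B|`, `A + B` is aperiodic and neither `A` nor `B` is quasi-periodic,
then the conclusion of Theorem 4.1 holds: (17), or a decomposition (i)–(iii) (with quasi-period `G`
and `(A, B)` itself of type (VI)).  Proof as printed: a common difference `d` of `A` and `B` exists
since `|A + B| = 6 < 9` (`exists_common_difference`); translating, `0, d ∈ A ∩ B`
(`conclusion_of_card_eq_three₀`), and the conclusion is translation invariant.
[cite: Grynkiewicz2009, §6 Claim 6 (proof of Thm 4.1, pp. 26–27)] -/
theorem conclusion_of_card_eq_three {A B : Finset G} (hA3 : #A = 3) (hB3 : #B = 3)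
    (hAB : #(A + B) = #A + #B) (haper : (A + B).addStab = {0})
    (hAqp : ¬ IsQuasiPeriodic A) (hBqp : ¬ IsQuasiPeriodic B) :
    (∃ α β : G, #(insert α A + insert β B) + 1 = #(insert α A) + #(insert β B)) ∨
      ∃ (K : AddSubgroup G) (A₁ A₀ B₁ B₀ : Finset G), IsGrynkiewiczDecomp K A B A₁ A₀ B₁ B₀ := by
  classical
  -- a common difference `d = a − a' = b − b' ≠ 0`
  have hlt : #(A + B) < #A * #B := by rw [hAB, hA3, hB3]; norm_num
  obtain ⟨a, ha, a', ha', b, hb, b', hb', hne, hdiff⟩ := exists_common_difference hlt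
  have hd0 : a - a' ≠ 0 := fun h => hne (sub_eq_zero.1 h)
  -- translate: `0, d ∈ (−a' + A) ∩ (−b' + B)`
  have hsum : ((-a') +ᵥ A) + ((-b') +ᵥ B) = (-a' + -b') +ᵥ (A + B) := vadd_add_vadd_eq₃ A B _ _
  have key := conclusion_of_card_eq_three₀ (A := (-a') +ᵥ A) (B := (-b') +ᵥ B) hd0
    (mem_vadd_finset.2 ⟨a', ha', by simp⟩)
    (mem_vadd_finset.2 ⟨a, ha, by rw [vadd_eq_add]; abel⟩)
    (mem_vadd_finset.2 ⟨b', hb', by simp⟩)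
    (mem_vadd_finset.2 ⟨b, hb, by rw [vadd_eq_add, hdiff]; abel⟩)
    (by rw [card_vadd_finset]; exact hA3) (by rw [card_vadd_finset]; exact hB3)
    (by rw [hsum, card_vadd_finset, card_vadd_finset, card_vadd_finset]; exact hAB)
    (by rw [hsum, addStab_vadd]; exact haper)
    (fun h => hAqp ((isQuasiPeriodic_vadd_iff _).1 h)) (fun h => hBqp ((isQuasiPeriodic_vadd_iff _).1 h))
  rcases key with h17 | hdec
  · exact Or.inl (seventeen_of_vadd h17)
  · exact Or.inr (exists_isGrynkiewiczDecomp_of_vadd hdec)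

end Grynkiewicz2009

end Literature.Combinatorics.Additive
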